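import Mathlib
import HarnessLib
import Summits.ResolutionOfSingularities.ResolutionOfSingularities.Theorems.WildQuotientsWildQuotientResolutionConductorOneChartDefs
import Summits.ResolutionOfSingularities.ResolutionOfSingularities.Theorems.WildQuotientsWildQuotientResolutionConductorOneAction
import Summits.ResolutionOfSingularities.ResolutionOfSingularities.Theorems.WildQuotientsWildQuotientResolutionPthConeDefs
import Summits.ResolutionOfSingularities.ResolutionOfSingularities.Theorems.WildQuotientsWildQuotientResolutionConductorOneFrameChartMap

/-!
# S2 F5b (part 1): the presentation map `ψ₀ : k[x]^{μ_p(w_I)} → M_I` of the conductor-𝟙 chart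
(crux stmt-ResolutionOfSingularities-15640 `WildQuotients.WildQuotientResolution`, line `Sketch`;
chain w45c post-V5 programme S2, design `L/res-L1-w45c-lead-1/S2-DESIGN.md` v1.1 §7 (7.2)/(7.7),
res-L1-w45c-plan-1 RULINGs 2026-08-27T17:07:17Z (R2) and 17:31:45Z (3). [OURS · L1 W4.5c] —
NOT a statement of the manuscript. Lead prover res-L1-w45c-lead-1.)

The weight-`0` cone `R₀ = ↥(PthCone.cone k n p (chartWeight p n I))` (weights `1` on `I`, `−1` off
`I`) is identified with the monoid algebra `k[S_w]` of its exponent monoid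
`S_w = {m : weight m = 0}` (`ConductorOne.coneMonoid`, `coneEmb`, `coneAlgEquiv`), and the
presentation map into the straightened chart ring `M_I = ChartRing k p n i I` is the lift of the
monoid hom
  `m ↦ x^m · u^{−d(m)}`,  `u = 1 − sᵖ⁻¹` (a unit of `M_I`),  `p · d(m) = ∑_{l∈I} m_l − ∑_{l∉I} m_l`
(`ConductorOne.twistDeg`, `coneDeg`, `chartMono`, **`ConductorOne.psi0`**, `psi0_coneMonomial`):
the monomial formula of design (7.2), `ψ₀(x^m) = s^{m_i} c^{m_K} e^{m_J} · u^{−d(m)}` (the unit `u` is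
res-D-pv-033's `ConductorOne.isUnit_one_sub_chartX_pow`, `…ConductorOneFrameChartMap`). Also named
here (plan-1 17:31:45Z (3)): the point ideal `ConductorOne.chartOrigin = (x_l : l)` of `M_I`.
Invariance of the `ψ₀`-images, the span theorem and the range/injectivity statements are the
sequel files `…ConductorOneFixedSpan.lean` / `…ConductorOnePresentation.lean`.
-/

-- single-problem summit: the doubled namespace component `ResolutionOfSingularities` is forced
set_option linter.dupNamespace false

noncomputable section

open MvPolynomial

namespace Summit.ResolutionOfSingularities.ResolutionOfSingularities.Theorems.WildQuotientResolution.ConductorOne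

/-! ## The weight-zero exponent monoid and the cone as its monoid algebra -/

section Cone

variable (k : Type) [Field k] (n p : ℕ) (w : Fin n → ZMod p)

/-- The exponent monoid of the cone: exponents of weight `0`. [OURS · L1 W4.5c] -/
def coneMonoid : AddSubmonoid (Fin n →₀ ℕ) := AddMonoidHom.mker (Finsupp.weight w)

/-- Membership in the exponent monoid is `weight = 0`. [OURS · L1 W4.5c] -/
theorem mem_coneMonoid_iff (m : Fin n →₀ ℕ) : m ∈ coneMonoid n p w ↔ Finsupp.weight w m = 0 :=
  AddMonoidHom.mem_mker

/-- The monomial `x^d` of weight `0` as an element of the cone (the same element as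
`PthCone.monomialElem` of `…PthConeIrrelevant`, restated here to keep this file's imports built).
[OURS · L1 W4.5c] -/
def coneMonomial (d : Fin n →₀ ℕ) (hd : Finsupp.weight w d = 0) : PthCone.cone k n p w :=
  ⟨monomial d 1, PthCone.monomial_mem_cone k n p w hd 1⟩

/-- The value of `coneMonomial`. [OURS · L1 W4.5c] -/
theorem coe_coneMonomial (d : Fin n →₀ ℕ) (hd : Finsupp.weight w d = 0) :
    ((coneMonomial k n p w d hd : PthCone.cone k n p w) : MvPolynomial (Fin n) k) = monomial d 1 :=
  rfl

/-- The embedding `k[S_w] → k[x]` (extend exponents along the inclusion). [OURS · L1 W4.5c] -/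
def coneEmb : AddMonoidAlgebra k (coneMonoid n p w) →ₐ[k] MvPolynomial (Fin n) k :=
  AddMonoidAlgebra.mapDomainAlgHom k k (coneMonoid n p w).subtype

/-- `coneEmb (single m c) = monomial m c`. [OURS · L1 W4.5c] -/
theorem coneEmb_single (m : coneMonoid n p w) (c : k) :
    coneEmb k n p w (AddMonoidAlgebra.single m c) = monomial m.1 c := by
  rw [coneEmb, AddMonoidAlgebra.mapDomainAlgHom_apply, AddMonoidAlgebra.mapDomain_single]
  exact MvPolynomial.single_eq_monomial _ _

/-- `coneEmb` is injective. [OURS · L1 W4.5c] -/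
theorem coneEmb_injective : Function.Injective (coneEmb k n p w) := by
  intro f g h
  rw [coneEmb, AddMonoidAlgebra.mapDomainAlgHom_apply, AddMonoidAlgebra.mapDomainAlgHom_apply] at h
  exact AddMonoidAlgebra.mapDomain_injective Subtype.val_injective h

/-- The range of `coneEmb` is the cone. [OURS · L1 W4.5c] -/
theorem coneEmb_range : (coneEmb k n p w).range = PthCone.cone k n p w := by
  apply le_antisymm
  · rintro _ ⟨f, rfl⟩
    refine AddMonoidAlgebra.induction_linear f ?_ ?_ ?_
    · rw [map_zero]; exact Subalgebra.zero_mem _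
    · intro f g hf hg; rw [map_add]; exact Subalgebra.add_mem _ hf hg
    · intro m c
      change coneEmb k n p w (AddMonoidAlgebra.single m c) ∈ _
      rw [coneEmb_single]
      exact PthCone.monomial_mem_cone k n p w ((mem_coneMonoid_iff n p w m.1).mp m.2) c
  · intro f hf
    rw [f.as_sum]
    refine Subalgebra.sum_mem _ fun m hm => ?_
    have hwm : Finsupp.weight w m = 0 := by
      have h := (PthCone.mem_cone_iff k n p w f).mp hf
      exact h (mem_support_iff.mp hm)
    exact ⟨AddMonoidAlgebra.single (⟨m, (mem_coneMonoid_iff n p w m).mpr hwm⟩ : coneMonoid n p w)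
      (coeff m f), coneEmb_single k n p w _ _⟩

/-- **The cone is the monoid algebra of its exponent monoid**: `↥(PthCone.cone) ≃ₐ[k] k[S_w]`.
[OURS · L1 W4.5c] -/
def coneAlgEquiv : PthCone.cone k n p w ≃ₐ[k] AddMonoidAlgebra k (coneMonoid n p w) :=
  ((AlgEquiv.ofInjective (coneEmb k n p w) (coneEmb_injective k n p w)).trans
    (Subalgebra.equivOfEq _ _ (coneEmb_range k n p w))).symm

/-- `coneEmb (coneAlgEquiv f) = f`. [OURS · L1 W4.5c] -/
theorem coneEmb_coneAlgEquiv (f : PthCone.cone k n p w) :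
    coneEmb k n p w (coneAlgEquiv k n p w f) = (f : MvPolynomial (Fin n) k) := by
  -- `g := coneAlgEquiv f` satisfies `(coneAlgEquiv.symm g : k[x]) = coneEmb g`
  set g := coneAlgEquiv k n p w f with hg
  have h1 : f = (coneAlgEquiv k n p w).symm g := by rw [hg, AlgEquiv.symm_apply_apply]
  rw [h1]
  rfl

/-- `coneAlgEquiv (x^d) = single d 1`. [OURS · L1 W4.5c] -/
theorem coneAlgEquiv_coneMonomial (d : Fin n →₀ ℕ) (hd : Finsupp.weight w d = 0) :
    coneAlgEquiv k n p w (coneMonomial k n p w d hd) =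
      AddMonoidAlgebra.single (⟨d, (mem_coneMonoid_iff n p w d).mpr hd⟩ : coneMonoid n p w) 1 := by
  apply coneEmb_injective k n p w
  rw [coneEmb_coneAlgEquiv, coneEmb_single, coe_coneMonomial]

end Cone

/-! ## The twist degree of an exponent for the chart `I` -/

section Degree

variable (n p : ℕ) (I : Finset (Fin n))

/-- The twist degree `∑_{l∈I} m_l − ∑_{l∉I} m_l ∈ ℤ` of an exponent. [OURS · L1 W4.5c] -/
def twistDeg (m : Fin n →₀ ℕ) : ℤ :=
  (∑ l ∈ I, (m l : ℤ)) - ∑ l ∈ Finset.univ \ I, (m l : ℤ)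

/-- `twistDeg` is additive. [OURS · L1 W4.5c] -/
theorem twistDeg_add (m m' : Fin n →₀ ℕ) :
    twistDeg n I (m + m') = twistDeg n I m + twistDeg n I m' := by
  simp only [twistDeg, Finsupp.coe_add, Pi.add_apply, Nat.cast_add, Finset.sum_add_distrib]
  ring

/-- `twistDeg 0 = 0`. [OURS · L1 W4.5c] -/
theorem twistDeg_zero : twistDeg n I 0 = 0 := by
  simp [twistDeg]

/-- The weight of `m` for `chartWeight p n I` is the twist degree read in `ZMod p`.
[OURS · L1 W4.5c] -/
theorem weight_chartWeight_eq (m : Fin n →₀ ℕ) :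
    Finsupp.weight (chartWeight p n I) m = ((twistDeg n I m : ℤ) : ZMod p) := by
  classical
  rw [Finsupp.weight_apply, Finsupp.sum_fintype _ _ (fun l => by simp), twistDeg]
  rw [← Finset.sum_filter_add_sum_filter_not Finset.univ (fun l => l ∈ I)]
  have hI : Finset.univ.filter (fun l => l ∈ I) = I := by
    ext l; simp
  have hIc : Finset.univ.filter (fun l => ¬ l ∈ I) = Finset.univ \ I := by
    ext l; simp
  rw [hI, hIc]
  push_cast
  have h1 : ∑ l ∈ I, m l • chartWeight p n I l = ∑ l ∈ I, ((m l : ℤ) : ZMod p) := by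
    refine Finset.sum_congr rfl fun l hl => ?_
    rw [chartWeight, if_pos hl, nsmul_eq_mul, mul_one, Int.cast_natCast]
  have h2 : ∑ l ∈ Finset.univ \ I, m l • chartWeight p n I l =
      -∑ l ∈ Finset.univ \ I, ((m l : ℤ) : ZMod p) := by
    rw [← Finset.sum_neg_distrib]
    refine Finset.sum_congr rfl fun l hl => ?_
    have hl' : l ∉ I := (Finset.mem_sdiff.mp hl).2
    rw [chartWeight, if_neg hl', nsmul_eq_mul, mul_neg, mul_one, Int.cast_natCast]
  rw [h1, h2, sub_eq_add_neg]
  simp only [Int.cast_natCast]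

/-- On weight-`0` exponents `p` divides the twist degree. [OURS · L1 W4.5c] -/
theorem dvd_twistDeg_of_weight_eq_zero (m : Fin n →₀ ℕ)
    (hm : Finsupp.weight (chartWeight p n I) m = 0) : (p : ℤ) ∣ twistDeg n I m := by
  rw [weight_chartWeight_eq] at hm
  exact (ZMod.intCast_zmod_eq_zero_iff_dvd _ p).mp hm

/-- The cone degree `d(m) := twistDeg(m)/p ∈ ℤ` (exact on weight-`0` exponents). [OURS · L1 W4.5c] -/
def coneDeg (m : Fin n →₀ ℕ) : ℤ := twistDeg n I m / p

/-- `twistDeg m = p · coneDeg m` on weight-`0` exponents. [OURS · L1 W4.5c] -/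
theorem twistDeg_eq_mul_coneDeg (m : Fin n →₀ ℕ) (hm : Finsupp.weight (chartWeight p n I) m = 0) :
    twistDeg n I m = p * coneDeg n p I m := by
  rw [coneDeg, Int.mul_ediv_cancel' (dvd_twistDeg_of_weight_eq_zero n p I m hm)]

/-- `coneDeg` is additive on weight-`0` exponents (`p ≠ 0`). [OURS · L1 W4.5c] -/
theorem coneDeg_add [Fact p.Prime] (m m' : Fin n →₀ ℕ) (hm : Finsupp.weight (chartWeight p n I) m = 0)
    (hm' : Finsupp.weight (chartWeight p n I) m' = 0) :
    coneDeg n p I (m + m') = coneDeg n p I m + coneDeg n p I m' := by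
  have hp : (p : ℤ) ≠ 0 := by exact_mod_cast (Fact.out : p.Prime).ne_zero
  have hadd : Finsupp.weight (chartWeight p n I) (m + m') = 0 := by rw [map_add, hm, hm', add_zero]
  have h := twistDeg_eq_mul_coneDeg n p I (m + m') hadd
  rw [twistDeg_add, twistDeg_eq_mul_coneDeg n p I m hm, twistDeg_eq_mul_coneDeg n p I m' hm',
    ← mul_add] at h
  exact (mul_left_cancel₀ hp h).symm

/-- `coneDeg 0 = 0`. [OURS · L1 W4.5c] -/
theorem coneDeg_zero : coneDeg n p I 0 = 0 := by
  simp [coneDeg, twistDeg_zero]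

end Degree

/-! ## Units of the chart ring and the monomial presentation `ψ₀` -/

section Chart

variable (k : Type) [Field k] (p n : ℕ) (i : Fin n) (I : Finset (Fin n))

/-- `h_M` is a unit of the chart ring. [OURS · L1 W4.5c] -/
theorem isUnit_algebraMap_chartDen :
    IsUnit (algebraMap (MvPolynomial (Fin n) k) (ChartRing k p n i I) (chartDen k p n i I)) :=
  IsLocalization.Away.algebraMap_isUnit (chartDen k p n i I)

/-- The unit `u = 1 − sᵖ⁻¹` of the chart ring. [OURS · L1 W4.5c] -/
def chartUUnit : (ChartRing k p n i I)ˣ := (isUnit_one_sub_chartX_pow k p n i I).unit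

/-- `↑chartUUnit = 1 − sᵖ⁻¹`. [OURS · L1 W4.5c] -/
theorem val_chartUUnit : (chartUUnit k p n i I : ChartRing k p n i I) = 1 - chartX k p n i I i ^ (p - 1) :=
  rfl

/-- **The monomial presentation on exponents**: `m ↦ x^m · u^{−d(m)}` is a monoid hom on the
weight-`0` exponent monoid. [OURS · L1 W4.5c] -/
def chartMono [Fact p.Prime] : Multiplicative (coneMonoid n p (chartWeight p n I)) →* ChartRing k p n i I where
  toFun m := algebraMap (MvPolynomial (Fin n) k) (ChartRing k p n i I) (monomial m.toAdd.1 1) *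
    ↑(chartUUnit k p n i I ^ (-coneDeg n p I m.toAdd.1))
  map_one' := by
    simp only [toAdd_one, ZeroMemClass.coe_zero, coneDeg_zero, neg_zero, zpow_zero, Units.val_one,
      mul_one]
    rw [← C_apply, C_1, map_one]
  map_mul' m m' := by
    have hm := (mem_coneMonoid_iff n p _ m.toAdd.1).mp m.toAdd.2
    have hm' := (mem_coneMonoid_iff n p _ m'.toAdd.1).mp m'.toAdd.2
    simp only [toAdd_mul, AddSubmonoid.coe_add]
    rw [coneDeg_add n p I _ _ hm hm', neg_add, zpow_add, Units.val_mul,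
      show monomial (m.toAdd.1 + m'.toAdd.1) (1 : k) = monomial m.toAdd.1 1 * monomial m'.toAdd.1 1 by
        rw [monomial_mul, one_mul], map_mul]
    ring

/-- Value of `chartMono`. [OURS · L1 W4.5c] -/
theorem chartMono_apply [Fact p.Prime] (m : Multiplicative (coneMonoid n p (chartWeight p n I))) :
    chartMono k p n i I m = algebraMap (MvPolynomial (Fin n) k) (ChartRing k p n i I)
      (monomial m.toAdd.1 1) * ↑(chartUUnit k p n i I ^ (-coneDeg n p I m.toAdd.1)) :=
  rfl

/-- **The presentation map `ψ₀ : R₀ = k[x]^{μ_p(w_I)} → M_I`** (design (7.2)). [OURS · L1 W4.5c] -/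
def psi0 [Fact p.Prime] : PthCone.cone k n p (chartWeight p n I) →ₐ[k] ChartRing k p n i I :=
  (AddMonoidAlgebra.lift k (ChartRing k p n i I) (coneMonoid n p (chartWeight p n I))
      (chartMono k p n i I)).comp
    (coneAlgEquiv k n p (chartWeight p n I)).toAlgHom

/-- **`ψ₀` on a monomial**: `ψ₀(x^d) = x^d · u^{−d(d)}`. [OURS · L1 W4.5c] -/
theorem psi0_coneMonomial [Fact p.Prime] (d : Fin n →₀ ℕ)
    (hd : Finsupp.weight (chartWeight p n I) d = 0) :
    psi0 k p n i I (coneMonomial k n p (chartWeight p n I) d hd) =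
      algebraMap (MvPolynomial (Fin n) k) (ChartRing k p n i I) (monomial d 1) *
        ↑(chartUUnit k p n i I ^ (-coneDeg n p I d)) := by
  change (AddMonoidAlgebra.lift k (ChartRing k p n i I) (coneMonoid n p (chartWeight p n I))
      (chartMono k p n i I)) (coneAlgEquiv k n p (chartWeight p n I)
        (coneMonomial k n p (chartWeight p n I) d hd)) = _
  rw [coneAlgEquiv_coneMonomial, AddMonoidAlgebra.lift_single, one_smul]
  rfl

/-- `ψ₀` of a scalar multiple of a monomial. [OURS · L1 W4.5c] -/
theorem psi0_smul_coneMonomial [Fact p.Prime] (d : Fin n →₀ ℕ)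
    (hd : Finsupp.weight (chartWeight p n I) d = 0) (c : k) :
    psi0 k p n i I (c • coneMonomial k n p (chartWeight p n I) d hd) =
      algebraMap (MvPolynomial (Fin n) k) (ChartRing k p n i I) (monomial d c) *
        ↑(chartUUnit k p n i I ^ (-coneDeg n p I d)) := by
  rw [map_smul, psi0_coneMonomial, Algebra.smul_def,
    IsScalarTower.algebraMap_apply k (MvPolynomial (Fin n) k) (ChartRing k p n i I) c,
    MvPolynomial.algebraMap_eq, ← mul_assoc, ← map_mul, C_mul_monomial, mul_one]

/-- **The point ideal of the chart**: `𝔪_Q = (x_l : l)`, the origin `s = c = e = 0` (the boolean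
point `Q_I`). [OURS · L1 W4.5c] -/
def chartOrigin : Ideal (ChartRing k p n i I) := Ideal.span (Set.range (chartX k p n i I))

/-- Each coordinate lies in the point ideal. [OURS · L1 W4.5c] -/
theorem chartX_mem_chartOrigin (l : Fin n) : chartX k p n i I l ∈ chartOrigin k p n i I :=
  Ideal.subset_span ⟨l, rfl⟩

end Chart

end Summit.ResolutionOfSingularities.ResolutionOfSingularities.Theorems.WildQuotientResolution.ConductorOne

end
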